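import Summits.Schanuel.Schanuel.Theorems.ZilberEacLineSurfaceDensity
import HarnessLib

/-!
# Surfaces over the graph of a polynomial: Mantova–Masser's density question for EVERY surface of
# the case over `x₁ = p(x₀)` when `Re(lc(p)·i^{deg p}) ≠ 0`

HONEST FRAMING.  Cell `pub-schanuel` (Zilber's Exponential-Algebraic Closedness, case ladder;
host summit Schanuel), seat 2, gen 17.  The assembly of gens 16–17: a surface of Mantova–Masser's
case (dim-π-S-1-free) whose additive projection lies over the graph `x₁ = p(x₀)` is
`W(p; P) = {x₁ = p(x₀), P(x₀; y₀, y₁) = 0}` with `P ∈ ℂ[x, y₀, y₁]` irreducible and `P(t; ·)`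
vanishing somewhere on `(ℂˣ)²` for infinitely many `t` (informal dictionary — an irreducible surface
inside the threefold `{x₁ = p(x₀)} × ℂ²` is a hypersurface there; the formal statements below take
`W(p; P)` as given and PROVE the case binders from these data).  For such `P` we prove the dichotomy
(`exists_support_y1_eq_zero`, `exists_rename_castSucc_eq`): either `P` has two monomials of
different `y₁`-degree, or `P = P̃₂` is the lift of an irreducible `P₂ ∈ ℂ[x₀, y₀]` with two
monomials of different `y₀`-degree (`finite_fibres_of_sameDegree` rules out the rest).  Hence
**`unprojectedDense_graphSurface_complete`**: `deg p ≥ 1`, `Re(lc(p)·i^{deg p}) ≠ 0`, `P` irreducible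
with torus fibres over infinitely many base points ⟹ `W(p; P)` is in the case AND has Zariski-dense
exponential points — by `unprojectedDense_graphSurface` (`deg p ≥ 2`, `y₁` present),
`unprojectedDense_lineSurface_of_im_ne_zero` (`deg p = 1`, i.e. a line of non-real slope, `y₁`
present) and `unprojectedDense_fibreCurveSurface` (`P ∈ ℂ[x₀, y₀]`).  For `deg p ≥ 2` the leading
term condition is used ONLY in the last branch.  What is NOT covered (precisely): graph bases with
`Re(lc(p)·i^{deg p}) = 0` AND fibre in the `(x₀, y₀)`-plane (HANDOFF O65), lines of real slope,
non-graph bases, `Fib(3,2)`, `EC(3,2)`.  NOT Schanuel's conjecture (neither used nor implied;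
EAC ⇏ SC); `EC(3,2)` stays OPEN; these are classes of instances of an OPEN question
(PLMS 129 (2024), §1 p. 5).
-/

noncomputable section

open Filter Topology Set Complex MvPolynomial
open Literature.NumberTheory.Transcendental Literature.ModelTheory.Zilber
open Literature.ModelTheory.ExponentialFields

set_option linter.dupNamespace false

namespace Summit.Schanuel.Schanuel.Theorems

/-! ## Part A. The dichotomy for irreducible `P` with torus fibres -/

section Algebra

variable {P : MvPolynomial (Fin 3) ℂ}

/-- If every monomial of `P` has `y₁`-degree `≥ 1` then `P = y₁ · Q`. -/
theorem exists_eq_X2_mul (hj : ∀ m ∈ P.support, 1 ≤ m 2) :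
    ∃ Q : MvPolynomial (Fin 3) ℂ, P = X 2 * Q := by
  classical
  refine ⟨∑ m ∈ P.support, monomial (m - Finsupp.single 2 1) (P.coeff m), ?_⟩
  rw [Finset.mul_sum]
  conv_lhs => rw [P.as_sum]
  refine Finset.sum_congr rfl fun m hm => ?_
  rw [MvPolynomial.X, monomial_mul, one_mul, add_tsub_cancel_of_le (Finsupp.single_le_iff.2 (hj m hm))]

/-- **An irreducible `P` with a zero `(t; c₀, c₁)`, `c₁ ≠ 0`, has a monomial free of `y₁`.** -/
theorem exists_support_y1_eq_zero (hirr : Irreducible P) {t : ℂ} {c : Fin 2 → ℂ} (h1 : c 1 ≠ 0)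
    (hc : MvPolynomial.eval ![t, c 0, c 1] P = 0) : ∃ m ∈ P.support, m 2 = 0 := by
  by_contra hall
  push Not at hall
  obtain ⟨Q, hPQ⟩ := exists_eq_X2_mul (fun m hm => Nat.one_le_iff_ne_zero.2 (hall m hm))
  have hX : ¬ IsUnit (X (2 : Fin 3) : MvPolynomial (Fin 3) ℂ) := MvPolynomial.X_prime.not_unit
  have hQ : IsUnit Q := (hirr.isUnit_or_isUnit hPQ).resolve_left hX
  have hQ' := hQ.map (MvPolynomial.eval ![t, c 0, c 1])
  rw [hPQ, map_mul, MvPolynomial.eval_X] at hc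
  have hc' : c 1 * MvPolynomial.eval ![t, c 0, c 1] Q = 0 := by simpa using hc
  rcases mul_eq_zero.1 hc' with h0 | h0
  · exact h1 h0
  · exact hQ'.ne_zero h0

/-- A `P ∈ ℂ[x, y₀, y₁]` without `y₁` is the lift of some `P₂ ∈ ℂ[x, y₀]`. -/
theorem exists_rename_castSucc_eq (h0 : ∀ m ∈ P.support, m 2 = 0) :
    ∃ P₂ : MvPolynomial (Fin 2) ℂ, rename (Fin.castSucc : Fin 2 → Fin 3) P₂ = P := by
  refine exists_rename_eq_of_vars_subset_range P _ (Fin.castSucc_injective 2) ?_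
  intro i hi
  rw [Finset.mem_coe, mem_vars_iff_mem_support] at hi
  obtain ⟨d, hd, hid⟩ := hi
  have hi2 : i ≠ Fin.last 2 := by
    rintro rfl
    rw [Finsupp.mem_support_iff] at hid
    exact hid (h0 d hd)
  obtain ⟨j, hj⟩ := Fin.exists_castSucc_eq.2 hi2
  exact ⟨j, hj⟩

/-- Irreducibility descends along the lift `ℂ[x, y₀] ↪ ℂ[x, y₀, y₁]`. -/
theorem irreducible_of_rename_castSucc {P₂ : MvPolynomial (Fin 2) ℂ}
    (h : Irreducible (rename (Fin.castSucc : Fin 2 → Fin 3) P₂)) : Irreducible P₂ := by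
  classical
  have hp : Prime (rename (Fin.castSucc : Fin 2 → Fin 3) P₂) :=
    UniqueFactorizationMonoid.irreducible_iff_prime.1 h
  have hfe : (Fin.castSucc : Fin 2 → Fin 3) =
      ((↑) : Set.range (Fin.castSucc : Fin 2 → Fin 3) → Fin 3) ∘
        (Equiv.ofInjective _ (Fin.castSucc_injective 2)) := by
    funext a; rfl
  rw [hfe, ← rename_rename] at hp
  have h2 := (MvPolynomial.prime_rename_iff _).1 hp
  exact ((MulEquiv.prime_iff
    (renameEquiv ℂ (Equiv.ofInjective _ (Fin.castSucc_injective 2)))).1 h2).irreducible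

/-- **If all monomials of `P₂ ≠ 0` have the same `y`-degree, only finitely many `t` carry a nonzero
fibre root** (`P₂(t, y) = y^j F(t)` with `F ≠ 0` a polynomial in `t`). -/
theorem finite_fibres_of_sameDegree {P₂ : MvPolynomial (Fin 2) ℂ} (hP : P₂ ≠ 0) {j : ℕ}
    (hj : ∀ v ∈ P₂.support, v 1 = j) :
    Set.Finite {t : ℂ | ∃ y : ℂ, y ≠ 0 ∧ MvPolynomial.eval ![t, y] P₂ = 0} := by
  classical
  have key : ∀ t y : ℂ, MvPolynomial.eval ![t, y] P₂ = y ^ j * MvPolynomial.eval ![t, 1] P₂ := by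
    intro t y
    rw [MvPolynomial.eval_eq', MvPolynomial.eval_eq', Finset.mul_sum]
    refine Finset.sum_congr rfl fun v hv => ?_
    simp only [Fin.prod_univ_two, Matrix.cons_val_zero, Matrix.cons_val_one, one_pow, mul_one,
      hj v hv]
    ring
  set F : Polynomial ℂ := MvPolynomial.aeval (![Polynomial.X, 1] : Fin 2 → Polynomial ℂ) P₂ with hF
  have hFev : ∀ t : ℂ, F.eval t = MvPolynomial.eval ![t, 1] P₂ := by
    intro t
    have h1 : (Polynomial.aeval t) F = MvPolynomial.aeval
        (fun i => Polynomial.aeval t ((![Polynomial.X, 1] : Fin 2 → Polynomial ℂ) i)) P₂ := by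
      rw [hF, ← AlgHom.comp_apply, MvPolynomial.comp_aeval]
    have h2 : (fun i => Polynomial.eval t ((![Polynomial.X, 1] : Fin 2 → Polynomial ℂ) i)) =
        ![t, 1] := by
      funext i
      fin_cases i <;> simp
    rw [Polynomial.coe_aeval_eq_eval] at h1
    rw [h1, h2]
    rfl
  have hF0 : F ≠ 0 := by
    intro hF0
    apply hP
    apply MvPolynomial.funext
    intro x
    rw [map_zero]
    have hx : x = ![x 0, x 1] := by funext i; fin_cases i <;> rfl
    rw [hx, key, ← hFev, hF0, Polynomial.eval_zero, mul_zero]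
  refine (Polynomial.finite_setOf_isRoot hF0).subset ?_
  rintro t ⟨y, hy, hty⟩
  rw [key] at hty
  have h3 : MvPolynomial.eval ![t, 1] P₂ = 0 := (mul_eq_zero.1 hty).resolve_left (pow_ne_zero _ hy)
  show F.IsRoot t
  rw [Polynomial.IsRoot, hFev]
  exact h3

end Algebra

/-! ## Part B. The complete theorem over graph bases with non-degenerate leading term -/

section Complete

variable (p : Polynomial ℂ) {P : MvPolynomial (Fin 3) ℂ}

/-- **Density for every surface of the case over `x₁ = p(x₀)`, `Re(lc(p)·i^{deg p}) ≠ 0`.**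
`deg p ≥ 1` with `Re(lc(p)·i^{deg p}) ≠ 0` (for `deg p = 1`: a line of non-real slope); `P`
irreducible; `P(t; ·)` has a zero in `(ℂˣ)²` for infinitely many `t` ⟹ the exponential points of
`{x₁ = p(x₀), P(x₀; y₀, y₁) = 0}` are Zariski dense.  (For `deg p ≥ 2` the leading-term condition
is used only when `P ∈ ℂ[x₀, y₀]`.)
[cite: MantovaMasser2023, §1 Further remarks, p. 5 (the question, open in general)] (new) -/
theorem unprojectedDense_graphSurface_complete (hd : 1 ≤ p.natDegree)
    (hre : (p.leadingCoeff * I ^ p.natDegree).re ≠ 0) (hirr : Irreducible P)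
    (hfib : Set.Infinite {t : ℂ | ∃ c : Fin 2 → ℂ, c 0 ≠ 0 ∧ c 1 ≠ 0 ∧
      MvPolynomial.eval ![t, c 0, c 1] P = 0}) :
    UnprojectedDense {w : Fin 2 ⊕ Fin 2 → ℂ | w (Sum.inl 1) = p.eval (w (Sum.inl 0)) ∧
      MvPolynomial.eval ![w (Sum.inl 0), w (Sum.inr 0), w (Sum.inr 1)] P = 0} := by
  obtain ⟨t, c, -, h1, hc⟩ := hfib.nonempty
  obtain ⟨m₀, hm₀, hm₀2⟩ := exists_support_y1_eq_zero hirr h1 hc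
  by_cases h2 : ∃ m ∈ P.support, m 2 ≠ 0
  · -- `y₁` is present: two `y₁`-degrees
    obtain ⟨m, hm, hm2⟩ := h2
    have h2' : ∃ m ∈ P.support, ∃ m' ∈ P.support, m 2 ≠ m' 2 :=
      ⟨m, hm, m₀, hm₀, by rw [hm₀2]; exact hm2⟩
    by_cases hd2 : 2 ≤ p.natDegree
    · exact unprojectedDense_graphSurface p hd2 hirr h2'
    · have hd1 : p.natDegree = 1 := by omega
      have hp : p = linePoly (p.coeff 1) (p.coeff 0) :=
        Polynomial.eq_X_add_C_of_natDegree_le_one hd1.le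
      have ha : (p.coeff 1).im ≠ 0 := by
        have hlc : p.leadingCoeff = p.coeff 1 := by rw [Polynomial.leadingCoeff, hd1]
        rw [hlc, hd1, pow_one] at hre
        simpa [Complex.mul_re] using hre
      rw [hp]
      exact unprojectedDense_lineSurface_of_im_ne_zero _ _ ha hirr h2'
  · -- `P ∈ ℂ[x₀, y₀]`
    push Not at h2
    obtain ⟨P₂, hP₂⟩ := exists_rename_castSucc_eq h2
    subst hP₂
    have hirr₂ : Irreducible P₂ := irreducible_of_rename_castSucc hirr
    have h1' : ∃ v ∈ P₂.support, ∃ v' ∈ P₂.support, v 1 ≠ v' 1 := by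
      by_contra hall
      push Not at hall
      obtain ⟨v₀, hv₀⟩ := MvPolynomial.ne_zero_iff.1 hirr₂.ne_zero
      have hv₀s : v₀ ∈ P₂.support := MvPolynomial.mem_support_iff.2 hv₀
      have hfin := finite_fibres_of_sameDegree hirr₂.ne_zero (fun v hv => hall v hv v₀ hv₀s)
      refine hfib (hfin.subset ?_)
      rintro t ⟨c, h0, -, hc⟩
      exact ⟨c 0, h0, by rwa [eval_vec3_rename_castSucc] at hc⟩
    rw [← fibreCurveSurface_eq]
    exact unprojectedDense_fibreCurveSurface p hd hre hirr₂ h1'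

/-- **Case certificate** under the same hypotheses (lines: non-rational slope; `deg p ≥ 2`:
`mmCase_graphSurface`). (new) -/
theorem mmCase_graphSurface_complete (hd : 1 ≤ p.natDegree)
    (hre : (p.leadingCoeff * I ^ p.natDegree).re ≠ 0) (hirr : Irreducible P)
    (hfib : Set.Infinite {t : ℂ | ∃ c : Fin 2 → ℂ, c 0 ≠ 0 ∧ c 1 ≠ 0 ∧
      MvPolynomial.eval ![t, c 0, c 1] P = 0}) :
    MMCaseDimPiOneFree {w : Fin 2 ⊕ Fin 2 → ℂ | w (Sum.inl 1) = p.eval (w (Sum.inl 0)) ∧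
      MvPolynomial.eval ![w (Sum.inl 0), w (Sum.inr 0), w (Sum.inr 1)] P = 0} := by
  by_cases hd2 : 2 ≤ p.natDegree
  · exact mmCase_graphSurface p P hd2 hirr hfib
  · have hd1 : p.natDegree = 1 := by omega
    have hp : p = linePoly (p.coeff 1) (p.coeff 0) :=
      Polynomial.eq_X_add_C_of_natDegree_le_one hd1.le
    have ha : (p.coeff 1).im ≠ 0 := by
      have hlc : p.leadingCoeff = p.coeff 1 := by rw [Polynomial.leadingCoeff, hd1]
      rw [hlc, hd1, pow_one] at hre
      simpa [Complex.mul_re] using hre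
    rw [hp]
    exact mmCase_lineSurface _ _ P ha hirr hfib

/-- **Mantova–Masser's question holds for every surface of the case over the graph of a polynomial
with `Re(lc·i^{deg}) ≠ 0`** (every line of non-real slope; every `x₁ = cx₀^d + …` with
`Re(c·i^d) ≠ 0`): case ∧ dense.
[cite: MantovaMasser2023, §1 Further remarks, p. 5 (the question, open in general)] (new) -/
theorem unprojectedDensityQuestion_graphSurface_complete (hd : 1 ≤ p.natDegree)
    (hre : (p.leadingCoeff * I ^ p.natDegree).re ≠ 0) (hirr : Irreducible P)
    (hfib : Set.Infinite {t : ℂ | ∃ c : Fin 2 → ℂ, c 0 ≠ 0 ∧ c 1 ≠ 0 ∧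
      MvPolynomial.eval ![t, c 0, c 1] P = 0}) :
    MMCaseDimPiOneFree {w : Fin 2 ⊕ Fin 2 → ℂ | w (Sum.inl 1) = p.eval (w (Sum.inl 0)) ∧
        MvPolynomial.eval ![w (Sum.inl 0), w (Sum.inr 0), w (Sum.inr 1)] P = 0} ∧
      UnprojectedDense {w : Fin 2 ⊕ Fin 2 → ℂ | w (Sum.inl 1) = p.eval (w (Sum.inl 0)) ∧
        MvPolynomial.eval ![w (Sum.inl 0), w (Sum.inr 0), w (Sum.inr 1)] P = 0} :=
  ⟨mmCase_graphSurface_complete p hd hre hirr hfib,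
    unprojectedDense_graphSurface_complete p hd hre hirr hfib⟩

/-- **Over graph bases of degree `≥ 2` with `y₁` present no leading-term condition is needed**:
`deg p ≥ 2`, `P` irreducible with a monomial involving `y₁` and torus fibres over infinitely many
base points ⟹ case ∧ dense. (new) -/
theorem unprojectedDensityQuestion_graphSurface_of_y1 (hd : 2 ≤ p.natDegree) (hirr : Irreducible P)
    (hy : ∃ m ∈ P.support, m 2 ≠ 0)
    (hfib : Set.Infinite {t : ℂ | ∃ c : Fin 2 → ℂ, c 0 ≠ 0 ∧ c 1 ≠ 0 ∧
      MvPolynomial.eval ![t, c 0, c 1] P = 0}) :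
    MMCaseDimPiOneFree {w : Fin 2 ⊕ Fin 2 → ℂ | w (Sum.inl 1) = p.eval (w (Sum.inl 0)) ∧
        MvPolynomial.eval ![w (Sum.inl 0), w (Sum.inr 0), w (Sum.inr 1)] P = 0} ∧
      UnprojectedDense {w : Fin 2 ⊕ Fin 2 → ℂ | w (Sum.inl 1) = p.eval (w (Sum.inl 0)) ∧
        MvPolynomial.eval ![w (Sum.inl 0), w (Sum.inr 0), w (Sum.inr 1)] P = 0} := by
  obtain ⟨t, c, -, h1, hc⟩ := hfib.nonempty
  obtain ⟨m₀, hm₀, hm₀2⟩ := exists_support_y1_eq_zero hirr h1 hc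
  obtain ⟨m, hm, hm2⟩ := hy
  exact unprojectedDensityQuestion_instance_graphSurface p P hd hirr
    ⟨m, hm, m₀, hm₀, by rw [hm₀2]; exact hm2⟩ hfib

end Complete

end Summit.Schanuel.Schanuel.Theorems
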